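import Literature.Probability.Percolation.QuadCrossingGeneralPosition
import Literature.Probability.Percolation.QuadCrossingNoiseOfFactorization
import Literature.Probability.Percolation.QuadCrossingContinuityEvents
import HarnessLib

/-!
# Schramm–Smirnov 2011, Thm. 1.7 and Cor. 1.8 (noise): split into Proposition 4.1 and Lemma 5.1

Topic `Literature/Probability/Percolation`; namespace `Literature.Probability.Percolation.QuadCrossing`.
Split record (librarian, fact-decompose) for the named fact
`Literature.Probability.Percolation.QuadCrossing.SchrammSmirnov2011_cor_1_8_noise`
(`QuadCrossingNoise.lean`: O. Schramm, S. Smirnov, *On the scaling limits of planar percolation*,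
Ann. Probab. 39 (2011), arXiv:1101.5820, Cor. 1.8 "Percolation is a noise" on the rectangle base)
and for its blocker `…SchrammSmirnov2011_thm_1_7` (Thm. 1.7, Factorization).

State of the tree (all PROVED): Cor. 1.8 (noise) follows from Thm. 1.7 alone
(`SchrammSmirnov2011_cor_1_8_noise_of_thm_1_7`, `QuadCrossingNoiseOfFactorization.lean`; the
independence half is a theorem, `QuadCrossingNoiseIndep.lean`), and Thm. 1.7 follows — exactly as
in its printed proof, p. 21: "By Proposition 4.1 and Corollary 5.2, we have `⊞_{Q₀} ∈ 𝓕_{D∖α}`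
(5.2). Since such collection of quads is dense in `𝒬_D`, Theorem 1.7 follows from Theorem 1.4 (2)"
— from the conclusion of Prop. 4.1 at the quads of a dense family
(`SchrammSmirnov2011_thm_1_7_of_frequently_gluing_finite_inter`, `QuadCrossingGeneralPosition.lean`:
Thm. 1.4, Cor. 5.2, the density of continuity quads in general position and the measure-theoretic
glue are theorems). The two inputs left are the children of this split:

1. `SchrammSmirnov2011_prop_4_1` (NEW named fact, this file) — **Proposition 4.1
   (Mesh-independent gluing)**, "the most technically difficult part of our paper" (§4: bays,
   beaches and coarse-graining over the discrete gluing Thm. 1.1, the a priori RSW/pivotal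
   estimates of Assumptions 1.1 — for bond-`ℤ²` Garban's appendix — and Lemmas 6.1–6.2);
2. `SchrammSmirnov2011_lemma_5_1` (EXISTING named fact, `QuadCrossingContinuityEvents.lean`) —
   Lemma 5.1, every crossing event is a continuity set of every subsequential limit (RSW
   continuity Lemma 6.1 + portmanteau), used here to know that the quads `𝒬_ε` produced by
   Prop. 4.1 are `μ`-continuity quads (the form the landed assembly consumes).

Assemblies (PROVED): `SchrammSmirnov2011_thm_1_7_holds_of : (1) → (2) → thm_1_7` and
`SchrammSmirnov2011_cor_1_8_noise_holds_of : (1) → (2) → cor_1_8_noise`. Neither child restates a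
parent: Prop. 4.1 is a uniform-in-the-mesh approximation of ONE crossing event by events of
finitely many quads off the cut (a statement about the discrete measures), Lemma 5.1 a null-frontier
statement; the parents are `σ`-field factorization / independence-and-generation statements about
the limit.

## Rendering of Prop. 4.1 and faithfulness

Printed (p. 17): "Let `D ⊂ ℂ` be some domain, and let `Q₀ ∈ 𝒬_D` be a piecewise smooth quad in `D`.
Suppose that `α ⊂ ℂ` is a finite union of finite length paths, with finitely many double points.
Consider a collection of percolation models indexed by a set `{η}`. Assume that `μ_η` converges to
(a subsequential) scaling limit `μ` as mesh `|η| → 0`. Then for every `ε > 0` there is a finite set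
of piecewise smooth quads `𝒬_ε ⊂ 𝒬_{D∖α}` and a subset `𝒲_ε ⊂ ℋ`, which is measurable with respect
to the finite `σ`-field `σ(⊞_Q, Q ∈ 𝒬_ε)`, such that `limsup_{|η|→0} μ_η(𝒲_ε ∆ ⊞_{Q₀}) < ε`."
Rendering: `D` open connected; the collection of models is critical bond percolation on `δₖℤ²`
along a sequence of meshes `δₖ → 0⁺` with `squareCrossingLaw D δₖ → μ` weakly (the tree's
`IsSubseqQuadLimit`); `α` is `IsFiniteLengthPathUnion`; `𝒬_ε` is a finite set `F` of quads with
carriers in `D ∖ α` (the printed "piecewise smooth" of the OUTPUT quads is dropped — a weaker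
conclusion); `𝒲_ε` is measurable for `MeasurableSpace.generateFrom (crossedEvent '' F)`; the
`limsup` is along the sequence (weaker than over all meshes). The INPUT quad `Q₀`: the printed
hypothesis "piecewise smooth" has no carrier in the tree; it is used in the source (§2, proof of
Thm. 1.1: "approximating if necessary, we can assume that `α` intersects `∂Q₀` at finitely many
points") to put `Q₀` in general position with respect to `α`, and the printed proof of Thm. 1.7
applies Prop. 4.1 only along a dense family of such quads. The fact is therefore recorded AT the
quads the landed proof of Thm. 1.7 uses: `Q₀` in general position (`α ∩ ∂[Q₀]` finite) whose
crossing event is a `μ`-continuity set — by Lemma 5.1 every quad is, and for an arbitrary quad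
`Q₀` the printed conclusion follows from the piecewise-smooth case by the sandwich
`Q' < Q₀ < Q''` of the proof of Lemma 5.1 (p. 21, with Lemma 6.1:
`limsup_η μ_η(⊞_{Q'} ∆ ⊞_{Q''})` small), since `⊞_{Q₀} ∆ ⊞_{Q'} ⊆ ⊞_{Q'} ∖ ⊞_{Q''}`. Every
deviation weakens the statement or is covered by that printed argument; nothing stronger than
Prop. 4.1 with the proof of Lemma 5.1 is asserted.

## References

* O. Schramm, S. Smirnov, Ann. Probab. 39 (2011) 1768–1814, arXiv:1101.5820: Prop. 4.1 (p. 17),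
  §2 (general position), Thm. 1.7 and its proof (p. 21), Lemma 5.1 (proof), Cor. 5.2, Lemma 6.1,
  Cor. 1.8. [SchrammSmirnov2011]
* C. Garban, Appendix to the above (the pivotal estimate (1.2) for bond percolation on `ℤ²`).
-/

noncomputable section

open scoped unitInterval Topology ENNReal NNReal symmDiff
open Set Filter Metric Function Complex MeasureTheory ProbabilityTheory

namespace Literature.Probability.Percolation

namespace QuadCrossing

variable {D : Set ℂ}

/-! ### The new child: Proposition 4.1 -/

/-- NAMED FACT — **Schramm–Smirnov 2011, Proposition 4.1 (Mesh-independent gluing)**, for critical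
bond percolation on `ℤ²`: for a domain `D` (open, connected), a sequence of meshes `δₖ → 0⁺` whose
quad-crossing laws `μ_{δₖ} = squareCrossingLaw D δₖ` converge weakly to `μ` (a subsequential scaling
limit), a cut `α` (finite union of finite-length paths), a quad `Q₀ ∈ 𝒬_D` in general position
with respect to `α` (`α ∩ ∂[Q₀]` finite) whose crossing event `⊞_{Q₀}` is a `μ`-continuity set, and
`ε > 0`: there are a finite set `F` of quads with carriers in `D ∖ α` and an event `W` measurable
for the finite `σ`-field `σ(⊞_Q : Q ∈ F)` with `limsup_k μ_{δₖ}(W ∆ ⊞_{Q₀}) < ε`. Printed for a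
piecewise smooth `Q₀` (and piecewise smooth output quads); see the module docstring for why the
present rendering (general position + continuity, along the sequence, output quads arbitrary) is
implied by the printed proposition together with the proof of Lemma 5.1. Printed proof: §4 of the
source ("the most technically difficult part of our paper") over the discrete gluing Thm. 1.1 (§2),
Assumptions 1.1 (RSW, the pivotal bound (1.2) — Garban's appendix for bond-`ℤ²`) and
Lemmas 6.1–6.2; not in the tree. Users take `(h : SchrammSmirnov2011_prop_4_1)`.
[cite: SchrammSmirnov2011, Prop. 4.1 (with §2 and the proof of Lemma 5.1)] -/
def SchrammSmirnov2011_prop_4_1 : Prop :=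
  ∀ (D : Set ℂ), IsOpen D → IsConnected D →
    ∀ (μ : FiniteMeasure (QuadConfig D)) (δs : ℕ → ℝ), (∀ k, 0 < δs k) →
      Tendsto δs atTop (𝓝 0) → Tendsto (fun k => squareCrossingLaw D (δs k)) atTop (𝓝 μ) →
    ∀ α : Set ℂ, IsFiniteLengthPathUnion α →
    ∀ Q₀ : Quad D,
      (μ : Measure (QuadConfig D)) (frontier (QuadConfig.crossedEvent Q₀)) = 0 →
      (α ∩ frontier Q₀.carrier).Finite →
    ∀ ε : ℝ, 0 < ε → ∃ (F : Set (Quad D)) (W : Set (QuadConfig D)), F.Finite ∧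
      (∀ Q ∈ F, Q.carrier ⊆ D \ α) ∧
      MeasurableSet[MeasurableSpace.generateFrom ((fun Q => QuadConfig.crossedEvent Q) '' F)] W ∧
      limsup (fun k => (squareCrossingLaw D (δs k) : Measure (QuadConfig D))
        (W ∆ QuadConfig.crossedEvent Q₀)) atTop < ENNReal.ofReal ε

/-! ### Assemblies (proved) -/

/-- **Thm. 1.7 (Factorization) from Prop. 4.1 and Lemma 5.1** (split assembly for
`SchrammSmirnov2011_thm_1_7`): Prop. 4.1 with `ε/1` gives `limsup < ε`, hence the approximation
holds frequently along the sequence; Lemma 5.1 makes the quads of `F` continuity quads; then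
`SchrammSmirnov2011_thm_1_7_of_frequently_gluing_finite_inter` (density of continuity quads in
general position, Cor. 5.2, Thm. 1.4 (2), all proved) concludes.
[cite: SchrammSmirnov2011, Thm. 1.7 (proof, p. 21), Prop. 4.1, Lemma 5.1] -/
theorem SchrammSmirnov2011_thm_1_7_holds_of (h41 : SchrammSmirnov2011_prop_4_1)
    (h51 : SchrammSmirnov2011_lemma_5_1) : SchrammSmirnov2011_thm_1_7 := by
  refine SchrammSmirnov2011_thm_1_7_of_frequently_gluing_finite_inter ?_
  intro D hD hD' μ δs hpos h0 hlim α hα Q₀ hQ₀ hfin ε hε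
  obtain ⟨F, W, hF, hFα, hW, hlimsup⟩ := h41 D hD hD' μ δs hpos h0 hlim α hα Q₀ hQ₀ hfin ε hε
  have hμ : IsSubseqQuadLimit D μ := ⟨δs, hpos, h0, hlim⟩
  refine ⟨F, hF, fun Q hQ => ⟨hFα Q hQ, h51 D hD hD'.nonempty μ hμ Q⟩, ?_⟩
  have hev : ∀ᶠ k in atTop, (squareCrossingLaw D (δs k) : Measure (QuadConfig D))
      (W ∆ QuadConfig.crossedEvent Q₀) < ENNReal.ofReal ε :=
    Filter.eventually_lt_of_limsup_lt hlimsup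
  exact (hev.mono fun k hk => ⟨W, hW, hk.le⟩).frequently

/-- **Cor. 1.8 (Percolation is a noise, rectangle base) from Prop. 4.1 and Lemma 5.1** (split
assembly for `SchrammSmirnov2011_cor_1_8_noise`): Thm. 1.7 from the two children, then
`SchrammSmirnov2011_cor_1_8_noise_of_thm_1_7`.
[cite: SchrammSmirnov2011, Cor. 1.8, Thm. 1.7, Prop. 4.1, Lemma 5.1] -/
theorem SchrammSmirnov2011_cor_1_8_noise_holds_of (h41 : SchrammSmirnov2011_prop_4_1)
    (h51 : SchrammSmirnov2011_lemma_5_1) : SchrammSmirnov2011_cor_1_8_noise :=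
  SchrammSmirnov2011_cor_1_8_noise_of_thm_1_7 (SchrammSmirnov2011_thm_1_7_holds_of h41 h51)

end QuadCrossing

end Literature.Probability.Percolation

end
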